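import Literature.AlgebraicGeometry.HodgeTheory.SmoothHyperplaneSectionPolarization
import Literature.AlgebraicGeometry.HodgeTheory.HyperplaneClassLine
import Literature.AlgebraicGeometry.HodgeTheory.HyperplaneClassHardLefschetzPullback
import Literature.AlgebraicGeometry.HodgeTheory.HyperplaneClassRestrictionNonzero
import HarnessLib

/-!
# The class of a smooth hyperplane section spans the line `ι^* H²(ℙᴺ(ℂ); ℂ)`; iterated sections have class `c • h²`

Family `hodge`, layer `Literature/AlgebraicGeometry/HodgeTheory`. Theorems only (no definitions, no
named facts, D-0026). Companion of `SmoothHyperplaneSectionPolarization` (the class `(u_a)_* 1` of a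
smooth hyperplane section `u_a : π⁻¹[a] ⟶ X` of `X ⊆ ℙᴺ` satisfies hard Lefschetz and is a polarisation
class) and of `HyperplaneClassLine` (`ι^* H²(ℙᴺ(ℂ); ℂ)` is the complex line through the
hyperplane-type class).

In print both say "`[X ∩ H] = h = c₁(𝒪_X(1)) = ι^*[H]`" (Voisin I Thm. 11.33 (proof), §11.1.2; Fulton,
*Young Tableaux* App. B §B.3), and then, for two hyperplanes `H, H'` meeting `X` in a smooth complete
intersection, "`[X ∩ H ∩ H'] = h²`" (functoriality of Gysin maps and the projection formula, Fulton
App. B (5)–(6)). On the tree's carrier the hyperplane class of an embedding is only pinned down up to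
a non-zero complex scalar (it is read through a Hodge model and a natural de Rham comparison), so the
statements below carry explicit scalars:

* `exists_iso_comp_compl_chart_subset_range_fiberι_toX` — the adapted re-embedding of
  `exists_embedding_compl_chart_subset_range_fiberι_toX` IS `e` followed by a projective linear
  AUTOMORPHISM `φ` of `ℙᴺ` (the statement there forgets this; it is needed to compare pull-backs
  along `e` and along the re-embedding);
* `exists_map_eq_smul_complexGysin_one_fiberι_toX` — **every class `e^* r`, `r ∈ H²(ℙᴺ(ℂ); ℂ)`, is a
  complex multiple `κ • (u_a)_* 1` of the class of the smooth hyperplane section `X ∩ H_a`**, any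
  orientation family (`H²(ℙᴺ) ∋ r = φ^*(φ⁻¹)^* r`, `(e ≫ φ)^* (φ⁻¹)^* r = s • [θ]` by `HyperplaneClassLine`,
  and `[θ] = κ₀ • (u_a)_* 1` by Thom–Gysin, `[θ]` dying off `u_a(π⁻¹[a])`); with `κ ≠ 0` for `r ≠ 0`
  (`exists_ne_zero_map_eq_smul_complexGysin_one_fiberι_toX`, by `HyperplaneClassRestrictionNonzero`),
  and conversely `(u_a)_* 1 = κ • e^* r` (`exists_ne_zero_complexGysin_one_fiberι_toX_eq_smul_map`);
* `exists_sections_complexGysin_one_eq_smul_sq` — granted the tree's Bertini fact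
  `Hartshorne1977_bertini_smoothHyperplaneSections`: **a smooth projective `X` of dimension `m + 2`,
  `m ≥ 1`, contains a smooth hyperplane section `u : S ⟶ X` (`dim S = m + 1`, class `σ = u_* 1_S` a
  polarisation class) and a smooth hyperplane section `i : C ⟶ S` of `S` IN THE SAME EMBEDDING
  (`dim C = m`) with `(i ≫ u)_* 1_C = c • (σ ∪ σ)`, `c ≠ 0`** (`i_* 1_C` and `u^* σ` are both non-zero
  multiples of `u^* e^* r₀`; `u_*(u^* σ ∪ 1) = σ ∪ u_* 1`);
* `exists_curve_complexGysin_one_eq_smul_sq` — the case of threefolds: **every smooth projective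
  complex threefold carries a smooth curve `j : C ⟶ X` (a closed immersion) and a polarisation class
  `σ` with `j_* 1_C = c • (σ ∪ σ)`, `c ≠ 0`** — the input «curve of class `c·σ²`» of the weight-one
  retractions of the square of a threefold (`Summits/…/Theorems/ThreefoldSquareWeightOneRetractions`).

## References

* [VoisinHodgeI2002] C. Voisin, Hodge Theory and Complex Algebraic Geometry I (CUP 2002), Thm. 7.10,
  §7.1.2, §7.3.2, §11.1.2 and Thm. 11.33 (proof).
* [VoisinHodgeII2003] C. Voisin, Hodge Theory and Complex Algebraic Geometry II (CUP 2003), §1.2.2,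
  §2.1.1, §2.3.1.
* [FultonYoungTableaux1997] W. Fulton, Young Tableaux (CUP 1997), Appendix B §B.1 (1), (5), (6) and §B.3.
* [Hartshorne1977] R. Hartshorne, Algebraic Geometry (1977), II Example 7.1.1, II Thm. 8.18, III Cor. 7.9.
* [HatcherAT2002] A. Hatcher, Algebraic Topology (2002), Thm. 3.19, §3.3 Thm. 3.26.
-/

noncomputable section

open scoped Manifold ContDiff
open CategoryTheory CategoryTheory.Limits AlgebraicGeometry MvPolynomial
open Literature.AlgebraicTopology.SingularHomology Literature.Geometry.Kaehler
open Literature.NumberTheory.Transcendental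
open Literature.AlgebraicGeometry.Motives
open Literature.AlgebraicGeometry.Motives.UniversalHyperplaneSection
open Literature.AlgebraicGeometry.Motives.AnalytificationKaehler (fubiniStudyPullbackForm)

namespace Literature.AlgebraicGeometry.HodgeTheory

section HodgeTheory

/-- `(g ≫ h)^* a = g^* (h^* a)` on elements (local copy of `complexBetti.map_comp_apply'`, file
`CorrespondenceCupProductIdentities`, not imported). [cite: FultonYoungTableaux1997, Appendix B §B.1 (1)] -/
private theorem map_comp_apply₀ {X' X Y : SchemeOver ℂ} (g : X' ⟶ X) (h : X ⟶ Y) (i : ℕ)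
    (a : complexBetti Y i) :
    complexBetti.map (g ≫ h) i a = complexBetti.map g i (complexBetti.map h i a) := by
  rw [complexBetti.map_comp, ModuleCat.comp_apply]

/-! ### The adapted re-embedding is `e` followed by an automorphism of `ℙᴺ` -/

section Section

variable {m : ℕ} {X : SchemeOver ℂ} (e : ProjectiveEmbedding X) (a : Fin (e.n + 1) → ℂ) (ha : a ≠ 0)

/-- **The adapted re-embedding, with its automorphism.** For `a ≠ 0` there are a projective linear
automorphism `φ` of `ℙᴺ` (the change of coordinates putting `ℓ_a = Σ aᵢ xᵢ` in the `j`-th coordinate,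
`a_j ≠ 0`, `exists_linearSubst_eq`, an isomorphism by `isIso_substMapHom`) and a chart index `j` such
that `e ≫ φ` is a closed immersion and every complex point of `X` outside the chart
`(e ≫ φ)⁻¹D₊(x_j) = e⁻¹D₊(ℓ_a)` lies in the image of `u_a : π⁻¹[a] ⟶ 𝒳 ⟶ X` — verbatim
`exists_embedding_compl_chart_subset_range_fiberι_toX`, remembering that the re-embedding is `e ≫ φ`.
[cite: Hartshorne1977, II Example 7.1.1] [cite: VoisinHodgeII2003, §2.1.1 and §2.3.1] -/
theorem exists_iso_comp_compl_chart_subset_range_fiberι_toX :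
    ∃ (φ : projectiveSpace e.n ℂ ⟶ projectiveSpace e.n ℂ) (_ : IsIso φ)
      (_ : IsClosedImmersion (e.ι ≫ φ).left) (j : Fin (e.n + 1)),
      ∀ P : ComplexPoints X, P.pt ∉ (GeneratingSections.affineChartData (e.ι ≫ φ)).U j →
        P.pt ∈ Set.range (fiberι (proj e.n e.ι) (ProjectiveSpace.pointOfVec ℂ a ha) ≫
          toX e.n e.ι).left.base := by
  classical
  letI := MvPolynomial.gradedAlgebra (σ := Fin (e.n + 1)) (R := ℂ)
  haveI : LocallyOfFiniteType X.hom := by rw [← Over.w e.ι]; infer_instance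
  haveI hu := isClosedImmersion_fiberι_proj_toX_left e a ha
  -- complex points of `X ∩ V₊(ℓ_a)` are in the image of `u_a`
  have key : ∀ P : ComplexPoints X,
      P.pt ∈ Set.range (e.hypersurfaceSectionι (linForm e.n a) (isHomogeneous_linForm e.n a)).left.base →
      P.pt ∈ Set.range (fiberι (proj e.n e.ι) (ProjectiveSpace.pointOfVec ℂ a ha) ≫
        toX e.n e.ι).left.base := fun P hP ↦ by
    have h1 : P ∈ Set.range (AlgPoints.map (L := ℂ)
        (e.hypersurfaceSectionι (linForm e.n a) (isHomogeneous_linForm e.n a))) :=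
      (AlgPoints.mem_range_map_iff_pt_mem _ P).2 hP
    rw [← range_map_fiberι_proj_toX_eq e a ha] at h1
    exact (AlgPoints.mem_range_map_iff_pt_mem _ P).1 h1
  have hrange := range_hypersurfaceSectionι e (linForm e.n a) (isHomogeneous_linForm e.n a) one_pos
  -- put `ℓ_a` in the `j`-th coordinate
  obtain ⟨j, hj⟩ : ∃ j, a j ≠ 0 := Function.ne_iff.mp ha
  obtain ⟨τ, τ', hτ, hτ', hinv, hinv', hτj⟩ := exists_linearSubst_eq a j hj
  haveI hleft : IsIso (ProjectiveSpace.substMap τ hτ τ' hτ' hinv).left := by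
    rw [ProjectiveSpace.substMap_left]
    exact isIso_substMapHom τ τ' hτ hτ' hinv hinv'
  haveI hiso : IsIso (ProjectiveSpace.substMap (k := ℂ) τ hτ τ' hτ' hinv) := by
    haveI : IsIso ((Over.forget _).map (ProjectiveSpace.substMap (k := ℂ) τ hτ τ' hτ' hinv)) := hleft
    exact isIso_of_reflects_iso _ (Over.forget _)
  refine ⟨ProjectiveSpace.substMap τ hτ τ' hτ' hinv, hiso, ?_, j, fun P hP ↦ key P ?_⟩
  · rw [Over.comp_left]
    infer_instance
  rw [hrange, Set.mem_preimage]
  have hℓ : linForm e.n a = τ j := by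
    rw [hτj]
    rfl
  -- `P ∉ (e.ι ≫ σ_τ)⁻¹ D₊(x_j) = e⁻¹ D₊(τ_j)`
  have hP' : ¬ (e.ι.left.base P.pt ∈ Proj.basicOpen (MvPolynomial.homogeneousSubmodule (Fin (e.n + 1)) ℂ)
      (ProjectiveSpace.substGraded τ hτ (MvPolynomial.X j))) := hP
  have hP'' : ProjectiveSpace.substGraded τ hτ (MvPolynomial.X j) ∈
      (e.ι.left.base P.pt).asHomogeneousIdeal := not_not.1 hP'
  rw [ProjectiveSpace.substGraded_apply, aeval_X] at hP''
  rw [hℓ]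
  exact (ProjectiveSpectrum.mem_zeroLocus _ _ _).2 (Set.singleton_subset_iff.2 hP'')

/-! ### `e^* H²(ℙᴺ(ℂ); ℂ) ⊆ ℂ · (u_a)_* 1` -/

/-- **Every class `e^* r`, `r ∈ H²(ℙᴺ(ℂ); ℂ)`, is a complex multiple of the class of a smooth
hyperplane section.** For `X ⊆ ℙᴺ` smooth projective of dimension `m + 1` (embedding `e`) and
`[a] ∈ (ℙᴺ)^*(ℂ)` with `π⁻¹[a] = X ∩ H_a` smooth projective of dimension `m`, and any orientation family
`μ`: `e^* r = κ • (u_a)_* 1` for some `κ ∈ ℂ`. With `φ`, `j` as in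
`exists_iso_comp_compl_chart_subset_range_fiberι_toX` and the hyperplane-type class `[θ]` of `e ≫ φ`
(read through a Hodge model `A` and a natural real de Rham family): `[θ]` dies off the chart, hence
off `u_a(π⁻¹[a])` (`HodgeModel.restrictCompl_eq_zero_of_pullback_eq_fubiniStudy`,
`restrictCompl_eq_zero_of_forall_pt`), so `[θ] = κ₀ • (u_a)_* 1` (Thom–Gysin,
`exists_complexGysin_eq_of_isClosedImmersion`, `H⁰(π⁻¹[a](ℂ)) = ℂ · 1`); and
`e^* r = (e ≫ φ)^* (φ⁻¹)^* r = s • [θ]` (`exists_map_eq_smul_of_pullback_eq_fubiniStudy`). In print: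
"`[X ∩ H] = h = ι^* c₁(𝒪(1))`". [cite: VoisinHodgeI2002, §7.1.2, §11.1.2 and Thm. 11.33 (proof)]
[cite: FultonYoungTableaux1997, Appendix B §B.3] [cite: HatcherAT2002, Thm. 3.19] -/
theorem exists_map_eq_smul_complexGysin_one_fiberι_toX (hX : IsSmoothProjective (m + 1) X)
    (hY : IsSmoothProjective m (fiberOver (proj e.n e.ι) (ProjectiveSpace.pointOfVec ℂ a ha)))
    (μ : OrientationFamily) (r : complexBetti (projectiveSpace e.n ℂ) 2) :
    ∃ κ : ℂ, complexBetti.map e.ι 2 r =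
      κ • complexGysin μ hY hX (fiberι (proj e.n e.ι) (ProjectiveSpace.pointOfVec ℂ a ha) ≫ toX e.n e.ι)
        (show 0 + 2 * (m + 1) = 2 + 2 * m by ring)
        (singularCohomology.one ℂ (ComplexPoints
          (fiberOver (proj e.n e.ι) (ProjectiveSpace.pointOfVec ℂ a ha)))) := by
  set u := fiberι (proj e.n e.ι) (ProjectiveSpace.pointOfVec ℂ a ha) ≫ toX e.n e.ι with hudef
  haveI : LocallyOfFiniteType X.hom := by rw [← Over.w e.ι]; infer_instance
  haveI : IsClosedImmersion u.left := isClosedImmersion_fiberι_proj_toX_left e a ha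
  set g : complexBetti X 2 := complexGysin μ hY hX u (show 0 + 2 * (m + 1) = 2 + 2 * m by ring)
    (singularCohomology.one ℂ (ComplexPoints
      (fiberOver (proj e.n e.ι) (ProjectiveSpace.pointOfVec ℂ a ha)))) with hgdef
  -- the adapted re-embedding `e ≫ φ` and its hyperplane-type class `H`
  obtain ⟨φ, hφ, hι', j, hsub⟩ := exists_iso_comp_compl_chart_subset_range_fiberι_toX e a ha
  haveI := hφ
  haveI := hι'
  obtain ⟨A⟩ := (nonempty_hodgeModel_holds (n := m + 1) (X := X)).nonempty hX
  obtain ⟨E, hE, -, -⟩ := exists_deRhamIsoFamily_holds A.model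
  have hθ := A.fubiniStudyPullbackForm_mem_closedSmoothForms (e.ι ≫ φ)
  obtain ⟨H, hH⟩ := A.pullback_surjective 2 (ofRealClass A.carrier 2 (E A.carrier 2
    (deRhamCohomology.mk ⟨fubiniStudyPullbackForm A.model (e.ι ≫ φ) A.toComplexPoints, hθ⟩)))
  -- `H` dies off `u_a(π⁻¹[a])`, hence `H = κ₀ • g`
  have hHsupp : complexBetti.restrictCompl X (Set.range u.left.base) 2 H = 0 :=
    restrictCompl_eq_zero_of_forall_pt (fun P hP ↦ hsub P hP) 2
      (A.restrictCompl_eq_zero_of_pullback_eq_fubiniStudy (e.ι ≫ φ) E hE hθ hH j)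
  obtain ⟨y, hy⟩ := exists_complexGysin_eq_of_isClosedImmersion μ hX hY u
    (show 0 + 2 * (m + 1) = 2 + 2 * m by ring) hHsupp
  obtain ⟨κ₀, rfl⟩ := exists_eq_smul_one μ hY y
  have hHg : H = κ₀ • g := by rw [← hy, map_smul]
  -- `r = φ^* (φ⁻¹)^* r` and `(e ≫ φ)^* ((φ⁻¹)^* r) = s • H`
  obtain ⟨s, hs, -⟩ := exists_map_eq_smul_of_pullback_eq_fubiniStudy hX A (e.ι ≫ φ) E hE hθ hH
    (complexBetti.map (inv φ) 2 r)
  have hr : complexBetti.map (e.ι ≫ φ) 2 (complexBetti.map (inv φ) 2 r) = complexBetti.map e.ι 2 r := by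
    rw [← map_comp_apply₀, Category.assoc, IsIso.hom_inv_id, Category.comp_id]
  refine ⟨s * κ₀, ?_⟩
  rw [← hr, hs, hHg, smul_smul]

/-- **… with `κ ≠ 0` when `r ≠ 0`**: `e^* r ≠ 0` for `r ≠ 0` and `dim X ≥ 1`
(`complexBetti_map_two_ne_zero_of_isClosedImmersion`). [cite: VoisinHodgeI2002, §3.3.2 and §7.1.2]
[cite: HatcherAT2002, Thm. 3.19] -/
theorem exists_ne_zero_map_eq_smul_complexGysin_one_fiberι_toX (hX : IsSmoothProjective (m + 1) X)
    (hY : IsSmoothProjective m (fiberOver (proj e.n e.ι) (ProjectiveSpace.pointOfVec ℂ a ha)))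
    (μ : OrientationFamily) {r : complexBetti (projectiveSpace e.n ℂ) 2} (hr : r ≠ 0) :
    ∃ κ : ℂ, κ ≠ 0 ∧ complexBetti.map e.ι 2 r =
      κ • complexGysin μ hY hX (fiberι (proj e.n e.ι) (ProjectiveSpace.pointOfVec ℂ a ha) ≫ toX e.n e.ι)
        (show 0 + 2 * (m + 1) = 2 + 2 * m by ring)
        (singularCohomology.one ℂ (ComplexPoints
          (fiberOver (proj e.n e.ι) (ProjectiveSpace.pointOfVec ℂ a ha)))) := by
  obtain ⟨κ, hκ⟩ := exists_map_eq_smul_complexGysin_one_fiberι_toX e a ha hX hY μ r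
  refine ⟨κ, ?_, hκ⟩
  rintro rfl
  rw [zero_smul] at hκ
  exact complexBetti_map_two_ne_zero_of_isClosedImmersion hX (by omega) e.ι hr hκ

/-- **Conversely, the class of a smooth hyperplane section is a non-zero multiple of `e^* r`** for
every `r ≠ 0` in `H²(ℙᴺ(ℂ); ℂ)`: `(u_a)_* 1 = κ • e^* r`, `κ ≠ 0` ("`[X ∩ H] = h`").
[cite: VoisinHodgeI2002, §11.1.2 and Thm. 11.33 (proof)] [cite: FultonYoungTableaux1997, Appendix B §B.3] -/
theorem exists_ne_zero_complexGysin_one_fiberι_toX_eq_smul_map (hX : IsSmoothProjective (m + 1) X)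
    (hY : IsSmoothProjective m (fiberOver (proj e.n e.ι) (ProjectiveSpace.pointOfVec ℂ a ha)))
    (μ : OrientationFamily) {r : complexBetti (projectiveSpace e.n ℂ) 2} (hr : r ≠ 0) :
    ∃ κ : ℂ, κ ≠ 0 ∧
      complexGysin μ hY hX (fiberι (proj e.n e.ι) (ProjectiveSpace.pointOfVec ℂ a ha) ≫ toX e.n e.ι)
        (show 0 + 2 * (m + 1) = 2 + 2 * m by ring)
        (singularCohomology.one ℂ (ComplexPoints
          (fiberOver (proj e.n e.ι) (ProjectiveSpace.pointOfVec ℂ a ha)))) =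
      κ • complexBetti.map e.ι 2 r := by
  obtain ⟨κ, hκ, h⟩ := exists_ne_zero_map_eq_smul_complexGysin_one_fiberι_toX e a ha hX hY μ hr
  exact ⟨κ⁻¹, inv_ne_zero hκ, by rw [h, smul_smul, inv_mul_cancel₀ hκ, one_smul]⟩

end Section

/-! ### Two hyperplane sections in the same embedding: a smooth section of a smooth section has class `c • σ²` -/

section Iterated

variable {m : ℕ} {X : SchemeOver ℂ}

/-- **A smooth codimension-two linear section has class `c • σ²`, `c ≠ 0`.** Granted Bertini
(`Hartshorne1977_bertini_smoothHyperplaneSections`), a smooth projective `X` of dimension `m + 2`,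
`m ≥ 1`, has a smooth hyperplane section `u : S ⟶ X` (`dim S = m + 1`, a closed immersion, class
`σ = u_* 1_S` a polarisation class) and, IN THE SAME EMBEDDING `S ⊆ X ⊆ ℙᴺ`, a smooth hyperplane
section `i : C ⟶ S` of `S` (`dim C = m`, a closed immersion) with `(i ≫ u)_* 1_C = c • (σ ∪ σ)` for
some `c ≠ 0`. Proof: with `r₀` spanning `H²(ℙᴺ(ℂ); ℂ)`, `e^* r₀ = κ_a • σ` and
`(u ≫ e)^* r₀ = u^* e^* r₀ = κ_b • i_* 1_C` (`exists_map_eq_smul_complexGysin_one_fiberι_toX` on `X`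
and on `S`), `κ_a κ_b ≠ 0` (`e^* r₀`, `(u ≫ e)^* r₀` satisfy hard Lefschetz,
`hasHardLefschetzProperty_map_of_forall_eq_smul`, hence are non-zero); then
`(i ≫ u)_* 1 = u_* i_* 1 = κ_b⁻¹ κ_a • u_*(u^* σ ∪ 1) = κ_b⁻¹ κ_a • (σ ∪ u_* 1)` (functoriality and
projection formula, `complexGysin_comp`, `complexGysin_cup`). In print: "`[X ∩ H ∩ H'] = h²`".
[cite: FultonYoungTableaux1997, Appendix B §B.1 (5), (6) and §B.3] [cite: VoisinHodgeI2002, §11.1.2 and Thm. 11.33 (proof)]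
[cite: Hartshorne1977, II Thm. 8.18 and III Cor. 7.9] -/
theorem exists_sections_complexGysin_one_eq_smul_sq
    (hBert : Hartshorne1977_bertini_smoothHyperplaneSections) (hX : IsSmoothProjective (m + 2) X)
    (hm : 1 ≤ m) :
    ∃ (S : SchemeOver ℂ) (hS : IsSmoothProjective (m + 1) S) (u : S ⟶ X)
      (C : SchemeOver ℂ) (hC : IsSmoothProjective m C) (i : C ⟶ S),
      IsClosedImmersion u.left ∧ IsClosedImmersion i.left ∧
      IsPolarizationClass (m + 2) X
        (complexGysin complexOrientationFamily hS hX u (show 0 + 2 * (m + 2) = 2 + 2 * (m + 1) by ring)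
          (singularCohomology.one ℂ (ComplexPoints S))) ∧
      ∃ c : ℂ, c ≠ 0 ∧
        complexGysin complexOrientationFamily hC hX (i ≫ u) (show 0 + 2 * (m + 2) = 4 + 2 * m by ring)
            (singularCohomology.one ℂ (ComplexPoints C)) =
          c • cupProduct (rfl : 2 + 2 = 4)
            (complexGysin complexOrientationFamily hS hX u (show 0 + 2 * (m + 2) = 2 + 2 * (m + 1) by ring)
              (singularCohomology.one ℂ (ComplexPoints S)))
            (complexGysin complexOrientationFamily hS hX u (show 0 + 2 * (m + 2) = 2 + 2 * (m + 1) by ring)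
              (singularCohomology.one ℂ (ComplexPoints S))) := by
  have hμ := hasPoincareDuality_complexOrientationFamily
  set e : ProjectiveEmbedding X := hX.isProjectiveOver.projectiveEmbedding with hedef
  haveI : LocallyOfFiniteType X.hom := by rw [← Over.w e.ι]; infer_instance
  -- a generator `r₀` of `H²(ℙᴺ(ℂ); ℂ)`; `e^* r₀ ≠ 0`
  obtain ⟨r₀, -, hgen⟩ := exists_isRationalClass_forall_eq_smul_projectiveSpace e.n
  have hHX0 : complexBetti.map e.ι 2 r₀ ≠ 0 :=
    HasHardLefschetzProperty.ne_zero hX (by omega) (hasHardLefschetzProperty_map_of_forall_eq_smul hX e.ι hgen)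
  -- the first section `u : S = π⁻¹[a] ⟶ X`
  obtain ⟨s, hs⟩ := universalSmoothLocus_nonempty e.ι hBert hX (by omega : 1 ≤ m + 1)
  obtain ⟨a, ha, rfl⟩ := ProjectiveSpace.exists_eq_pointOfVec s
  have hS : IsSmoothProjective (m + 1) (fiberOver (proj e.n e.ι) (ProjectiveSpace.pointOfVec ℂ a ha)) :=
    (mem_universalSmoothLocus_iff e.ι _).1 hs
  set S := fiberOver (proj e.n e.ι) (ProjectiveSpace.pointOfVec ℂ a ha) with hSdef
  set u : S ⟶ X := fiberι (proj e.n e.ι) (ProjectiveSpace.pointOfVec ℂ a ha) ≫ toX e.n e.ι with hudef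
  haveI hucl : IsClosedImmersion u.left := isClosedImmersion_fiberι_proj_toX_left e a ha
  set σ : complexBetti X 2 := complexGysin complexOrientationFamily hS hX u
    (show 0 + 2 * (m + 2) = 2 + 2 * (m + 1) by ring) (singularCohomology.one ℂ (ComplexPoints S)) with hσdef
  have hσ : IsPolarizationClass (m + 2) X σ := isPolarizationClass_complexGysin_one_fiberι_toX e a ha hX hS
  -- `e^* r₀ = κa • σ`, `κa ≠ 0`
  obtain ⟨κa, hκa⟩ := exists_map_eq_smul_complexGysin_one_fiberι_toX e a ha hX hS complexOrientationFamily r₀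
  have hκa' : complexBetti.map e.ι 2 r₀ = κa • σ := hκa
  have hκa0 : κa ≠ 0 := by
    rintro rfl
    exact hHX0 (by rw [hκa', zero_smul])
  -- the embedding `u ≫ e` of `S` and the second section `i : C = π_S⁻¹[b] ⟶ S`
  have hScl : IsClosedImmersion (u ≫ e.ι).left := by
    rw [Over.comp_left]
    infer_instance
  set eS : ProjectiveEmbedding S := ⟨e.n, u ≫ e.ι, hScl⟩ with heSdef
  haveI : LocallyOfFiniteType S.hom := by rw [← Over.w eS.ι]; infer_instance
  have hHS0 : complexBetti.map eS.ι 2 r₀ ≠ 0 :=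
    HasHardLefschetzProperty.ne_zero hS (by omega) (hasHardLefschetzProperty_map_of_forall_eq_smul hS eS.ι hgen)
  obtain ⟨t, ht⟩ := universalSmoothLocus_nonempty eS.ι hBert hS hm
  obtain ⟨b, hb, rfl⟩ := ProjectiveSpace.exists_eq_pointOfVec t
  have hC : IsSmoothProjective m (fiberOver (proj eS.n eS.ι) (ProjectiveSpace.pointOfVec ℂ b hb)) :=
    (mem_universalSmoothLocus_iff eS.ι _).1 ht
  set C := fiberOver (proj eS.n eS.ι) (ProjectiveSpace.pointOfVec ℂ b hb) with hCdef
  set i : C ⟶ S := fiberι (proj eS.n eS.ι) (ProjectiveSpace.pointOfVec ℂ b hb) ≫ toX eS.n eS.ι with hidef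
  haveI hicl : IsClosedImmersion i.left := isClosedImmersion_fiberι_proj_toX_left eS b hb
  set τ : complexBetti S 2 := complexGysin complexOrientationFamily hC hS i
    (show 0 + 2 * (m + 1) = 2 + 2 * m by ring) (singularCohomology.one ℂ (ComplexPoints C)) with hτdef
  -- `u^* e^* r₀ = κb • τ`, `κb ≠ 0`
  obtain ⟨κb, hκb⟩ := exists_map_eq_smul_complexGysin_one_fiberι_toX eS b hb hS hC complexOrientationFamily r₀
  have hκb' : complexBetti.map (u ≫ e.ι) 2 r₀ = κb • τ := hκb
  have hκb0 : κb ≠ 0 := by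
    rintro rfl
    exact hHS0 (by rw [zero_smul] at hκb'; exact hκb')
  have hτ : τ = (κb⁻¹ * κa) • complexBetti.map u 2 σ := by
    have h1 : complexBetti.map u 2 (complexBetti.map e.ι 2 r₀) = κb • τ := by
      rw [← map_comp_apply₀]
      exact hκb'
    rw [hκa', map_smul] at h1
    rw [mul_smul, h1, smul_smul, inv_mul_cancel₀ hκb0, one_smul]
  -- `(i ≫ u)_* 1 = u_* τ = κb⁻¹ κa • u_* (u^* σ ∪ 1) = κb⁻¹ κa • (σ ∪ σ)`
  refine ⟨S, hS, u, C, hC, i, hucl, hicl, hσ, κb⁻¹ * κa, mul_ne_zero (inv_ne_zero hκb0) hκa0, ?_⟩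
  have hcomp := complexGysin_comp hμ hC hS hX i u
    (show 0 + 2 * (m + 1) = 2 + 2 * m by ring) (show 2 + 2 * (m + 2) = 4 + 2 * (m + 1) by ring)
  have hcomp' : complexGysin complexOrientationFamily hC hX (i ≫ u) (show 0 + 2 * (m + 2) = 4 + 2 * m by ring)
      (singularCohomology.one ℂ (ComplexPoints C)) =
      complexGysin complexOrientationFamily hS hX u (show 2 + 2 * (m + 2) = 4 + 2 * (m + 1) by ring) τ := by
    rw [hcomp]
    rfl
  have hproj := complexGysin_cup hμ hS hX u (p := 2) (q := 0) (a := 2) (b := 4) (q' := 2)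
    (Nat.add_zero 2) (show 2 + 2 * (m + 2) = 4 + 2 * (m + 1) by ring)
    (show 0 + 2 * (m + 2) = 2 + 2 * (m + 1) by ring) rfl σ (singularCohomology.one ℂ (ComplexPoints S))
  rw [cupProduct_one] at hproj
  have hproj' : complexGysin complexOrientationFamily hS hX u (show 2 + 2 * (m + 2) = 4 + 2 * (m + 1) by ring)
      (complexBetti.map u 2 σ) = cupProduct (rfl : 2 + 2 = 4) σ σ := hproj
  rw [hcomp', hτ, map_smul, hproj']

/-- **Threefolds: a smooth curve of class `c • σ²`.** Granted Bertini, every smooth projective complex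
threefold `X` carries a smooth projective curve `C` with a closed immersion `j : C ⟶ X` and a
polarisation class `σ ∈ H²(X(ℂ); ℂ)` such that `j_* 1_C = c • (σ ∪ σ)` for some `c ≠ 0` (a smooth
complete intersection of two hyperplane sections in one projective embedding; `σ` = the class of the
first section). This is the input «curve of class `c·σ²`» of the weight-one curve retractions of the
square of a threefold. [cite: FultonYoungTableaux1997, Appendix B §B.1 (5), (6) and §B.3]
[cite: Hartshorne1977, II Thm. 8.18 and III Cor. 7.9] [cite: VoisinHodgeI2002, §11.1.2, Thm. 6.25 and Rem. 6.27] -/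
theorem exists_curve_complexGysin_one_eq_smul_sq
    (hBert : Hartshorne1977_bertini_smoothHyperplaneSections) (hX : IsSmoothProjective 3 X) :
    ∃ (C : SchemeOver ℂ) (hC : IsSmoothProjective 1 C) (j : C ⟶ X) (σ : complexBetti X 2),
      IsClosedImmersion j.left ∧ IsPolarizationClass 3 X σ ∧ ∃ c : ℂ, c ≠ 0 ∧
        complexGysin complexOrientationFamily hC hX j (rfl : 0 + 2 * 3 = 4 + 2 * 1)
            (singularCohomology.one ℂ (ComplexPoints C)) =
          c • cupProduct (rfl : 2 + 2 = 4) σ σ := by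
  obtain ⟨S, hS, u, C, hC, i, hu, hi, hσ, c, hc, hcls⟩ :=
    exists_sections_complexGysin_one_eq_smul_sq (m := 1) hBert hX le_rfl
  haveI := hu
  haveI := hi
  refine ⟨C, hC, i ≫ u, _, ?_, hσ, c, hc, hcls⟩
  rw [Over.comp_left]
  infer_instance

end Iterated

end HodgeTheory

end Literature.AlgebraicGeometry.HodgeTheory

end
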